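import Mathlib.Algebra.BigOperators.Finprod
import Literature.NumberTheory.DiophantineGeometry.GenEllConductorDifferent
import HarnessLib

/-!
# Joshi, *Arithmetic Teichmüller Spaces IV* (arXiv:2403.10430v2) §4.6 «The log-Different + log-Conductor Theorem» (Thm. 4.6.1,
# Rmk. 4.6.2, Cor. 4.6.15, Rmk. 4.6.16) — TYPED over Mathlib number fields; Thm. 4.6.1 (2) PROVED

Record file of the abc-iut cell, branch E «type Joshi's construction, test vs S» (rung LADDER-ABC:A2.E; seat abc-iut-E-t27,
slot T-27, `HOME/plan/E/t27/INVENTORY.tsv`). **No side is taken** on [IUTchIII] Cor. 3.12, on Joshi's claims, or on Mochizuki's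
reports on them; the source is an unrefereed arXiv preprint («Preliminary version for comments»); TYPED ≠ PROVED ≠ ENDORSED.
Locators «p.N l.M» = line M of page file `pNNNN.txt` of the render `HOME/lit/renders/Joshi-arxiv-2403.10430/` (v2). OBJECT file
(plan/E/E-PLAN.md R14): imports Mathlib / Literature only, binds no frozen `Cor312*`/`Thm311*` decl (nearest ones are NAMED in
docstrings). «disputed» in the claim tags is the registered status word recording that a dispute about the series exists in
print (Mochizuki's Report 2024-03) — nothing else.

CONTENT ([J-IV] §4.6 (p.46 l.1 – p.49 l.30), over Mathlib number fields): `logDiff M := [M:ℚ]⁻¹·log N(𝔡_{𝓞_M/ℤ})` (Joshi's `log d_M`,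
(4.3.1)–(4.3.2); `= [M:ℚ]⁻¹·log|disc M|` by Mathlib `NumberField.absNorm_differentIdeal` — Prop. 4.3.5 in this reading),
`logRedTate M T := [M:ℚ]⁻¹·Σ_{w∈T} log N(w)` (Joshi's `log f_M`, `f_M = (q_M)_red` supported on `T = V^{odd,ss}_M`, §4.4), `ssAbove L
M S` = the primes of `M` above `S` (his `V^{odd,ss}_M`, «the inverse image», p.40 l.35–40). **Thm. 4.6.1 (2) «0 ≤ (log d_M + log
f_M) − (log d_L + log f_L)» is PROVED** (`logDiffCond_le`, `thm461_2`) for EVERY extension `M/L` and every finite `S`, from the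
tree's kernel proof of the number-field content of [GenEll] Prop. 1.7 (i)
(`Literature.NumberTheory.DiophantineGeometry.GenEll.cond_sub_cond_le_logdisc_sub_logdisc`; p.46 l.6–11 calls the printed proof of
[GenEll] Prop. 1.7 «not adequately documented» — the tree's route is Mathlib's `pow_sub_one_dvd_differentIdeal` + transitivity of
the different; different route, no side). Items (1), (3), (4), (5), Cor. 4.6.15 are typed as CLAIMS with `τ_{w|v} := d_{w|v} −
(e_{w|v} − 1)` as in (4.6.4); `tau_eq_zero_of_isUnramifiedAt` and `cor4615_lower` are proved.

FAITHFULNESS FLAGS for the ref-x lane (statement/proof mismatches located INSIDE the preprint; not adjudications).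
F-a: Thm. 4.6.1 (1) (p.46 l.26–35) carries a factor `e_{w|v}` and «1 ≤ τ_w ≤ ord_v(e_{w|v})», whereas the proof's (4.6.4)/(4.6.8)
(p.47 l.16–24, p.48 l.14–24) have no factor and `τ_{w|v} ∈ [1, e_{w|v}·ord_v(e_{w|v})]`; `Formula461` types (4.6.8). F-b: (4.6.6)
(p.47 l.41–108) sums `log f_L − log f_M` over ALL of `V^non_L`, `V^non_M` (divergent as written) while §4.4 supports `f` on
`V^{odd,ss}` only; with the printed definition (4.6.5) − (4.6.6) drops `(1/[M:ℚ])·Σ_{v ∉ V^{odd,ss}_L} Σ_{w|v} (e_{w|v} − 1)·f_{w|v}·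
log v ≥ 0`, so (1)/(3)/(4) as printed presuppose «M/L unramified outside V^{odd,ss}_L»; (2) is unaffected (the dropped term is
`≥ 0`) and is proved here unconditionally. F-c: `S_wild` occurs in (5) (p.46 l.42) but is introduced only in Cor. 4.6.15 (p.49
l.7); typed with `S_wild` explicit. F-d: Cor. 4.6.15 «c depending on C, [M:L], S_wild» (p.49 l.17) while `[M:L]` ranges over the
family (proof l.29–30: «L, d, [M:L], S_wild»); typed with `c` depending on `(L, V^{odd,ss}_L, d, S, S_wild)`.

Rmk. 4.6.16 (p.49 l.19–22: the arithmetic-surface case of [Bombieri–Gubler 2006, Prop. 14.4.6] / [GenEll] Prop. 1.7 (i) needs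
vertical ramification) is locator-only. Companion: `Joshi/ATS4TateDivisors.lean` (§4.5). Deliberately NOT here: any `Cor312*`/
`Thm311*` binding (R14), the §4.1–§4.4 objects (T-26), the upper bound «τ ≤ e·ord(e)» ([Bombieri–Gubler 2006, B.2.12]; local
form = the tree's [IUTchIV] Prop. 1.3, FACT-LIST F-2234/F-2235) as a theorem. No `sorry`, axiom, instance, notation, or new
`Prop` fact. [claim: Joshi2024ATS4, status: disputed].
-/

noncomputable section

namespace Summit.ABC.IUTFork.Joshi.ATS4

/-! ## The log-Different + log-Conductor Theorem over Mathlib number fields ([J-IV] §4.6) -/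

namespace LogDiffCond

open NumberField IsDedekindDomain Ideal Module

variable (L M : Type*) [Field L] [NumberField L] [Field M] [NumberField M] [Algebra L M]

/-- **`log d_M`**, the normalised arithmetic degree of the different of `M/ℚ` ([J-IV] (4.3.1)–(4.3.2) p.39 l.41 – p.40 l.1:
`d_M = Σ_w ord_w(diff_{𝓞_{M,w}/ℤ_p})·w`, `log d_M = (1/[M:ℚ])·Σ_w d_{M,w}·log w`), read over Mathlib as `[M:ℚ]⁻¹·log N(𝔡_{𝓞_M/ℤ})`
(the norm of the global different is the product of the local contributions). Slot T-26 owns §4.3 (merge-debt: equality lemma).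
[claim: Joshi2024ATS4, status: disputed] -/
def logDiff (M : Type*) [Field M] [NumberField M] : ℝ :=
  (finrank ℚ M : ℝ)⁻¹ * Real.log (absNorm (differentIdeal ℤ (𝓞 M)) : ℝ)

/-- **[J-IV] Proposition 4.3.5** (p.40 l.16–21) in this reading: `log d_M = log disc_{M/ℚ} = [M:ℚ]⁻¹·log|disc M|` — Mathlib's
`NumberField.absNorm_differentIdeal` (`N(𝔡_{𝓞_M/ℤ}) = |disc M|`). PROVED. [cite: BombieriGubler2006, Prop B.1.19] -/
theorem logDiff_eq_log_discr : logDiff M = (finrank ℚ M : ℝ)⁻¹ * Real.log ((discr M).natAbs : ℝ) := by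
  rw [logDiff, NumberField.absNorm_differentIdeal M (𝓞 M)]

/-- **`log f_M`** for the reduced Tate divisor `f_M = (q_M)_red = Σ_{w ∈ T} 1·w` supported on a finite set `T` of primes
([J-IV] §4.4 p.41 l.2–14: `log(f_M) = (1/[M:ℚ])·deg(f_M)`, `deg = Σ_w 1·log w`, «log w» = log of the residue cardinality
= `log N(w)`, §4.2 p.39 l.6–10). Slot T-26 owns `f_M` (merge-debt). [claim: Joshi2024ATS4, status: disputed] -/
def logRedTate (T : Finset (HeightOneSpectrum (𝓞 M))) : ℝ :=
  (finrank ℚ M : ℝ)⁻¹ * ∑ w ∈ T, Real.log (absNorm w.asIdeal : ℝ)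

/-- **`log d_M + log f_M`**, the quantity Thm. 4.6.1 compares along `M/L` ([J-IV] p.46 l.26; Rmk. 4.6.2 p.47 l.1–4: `log f` «is the
conductor of C/L at its primes of semi-stable reduction», `log d` «the "log-different" in [Mochizuki, 2010]»; tree vocabulary:
`GenEll.NFPoint.logDiff`, `Thm110StepII.PlaceData.logDiff/logCond`). [claim: Joshi2024ATS4, status: disputed] -/
def logDiffCond (T : Finset (HeightOneSpectrum (𝓞 M))) : ℝ := logDiff M + logRedTate M T

/-- The primes of `M` above a finite set `S` of primes of `L` form a finite set (finitely many primes over each `v`, Mathlib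
`IsDedekindDomain.primesOver_finite`). [folklore] -/
theorem finite_setOf_under_mem (S : Finset (HeightOneSpectrum (𝓞 L))) :
    {w : HeightOneSpectrum (𝓞 M) | w.under (𝓞 L) ∈ S}.Finite := by
  refine Set.Finite.of_finite_image (f := fun w : HeightOneSpectrum (𝓞 M) => w.asIdeal) ?_
    (fun w _ w' _ h => HeightOneSpectrum.ext h)
  refine (Set.Finite.biUnion S.finite_toSet fun v _ => by
    haveI := v.isMaximal
    exact IsDedekindDomain.primesOver_finite v.asIdeal (𝓞 M)).subset ?_
  rintro _ ⟨w, hw, rfl⟩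
  exact Set.mem_biUnion hw ⟨w.isPrime, ⟨rfl⟩⟩

/-- **`V^{odd,ss}_M`** from `V^{odd,ss}_L`: the primes of `M` lying over `S` ([J-IV] §4.4 p.40 l.35–40: «Let V^{odd,ss}_M be the
inverse image of the set of primes … over which C_{L_mod} has semi-stable reduction»). [claim: Joshi2024ATS4, status: disputed] -/
def ssAbove (S : Finset (HeightOneSpectrum (𝓞 L))) : Finset (HeightOneSpectrum (𝓞 M)) :=
  (finite_setOf_under_mem L M S).toFinset

variable {L M} in
/-- `w ∈ V^{odd,ss}_M ↔ (w ∩ 𝓞_L) ∈ V^{odd,ss}_L`. [claim: Joshi2024ATS4, status: disputed] -/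
theorem mem_ssAbove {S : Finset (HeightOneSpectrum (𝓞 L))} {w : HeightOneSpectrum (𝓞 M)} :
    w ∈ ssAbove L M S ↔ w.under (𝓞 L) ∈ S := by
  simp [ssAbove]

/-- Inverse images compose along `L₀ ⊆ L ⊆ M`: the primes of `M` over `V^{odd,ss}_L = ssAbove L₀ L S₀` are the primes of `M` over
`S₀` — so Joshi's `V^{odd,ss}_M` (defined from `L_mod`) is also the inverse image of `V^{odd,ss}_L` (used implicitly in (4.6.6)).
[folklore] -/
theorem ssAbove_ssAbove (L₀ : Type*) [Field L₀] [NumberField L₀] [Algebra L₀ L] [Algebra L₀ M] [IsScalarTower L₀ L M]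
    (S₀ : Finset (HeightOneSpectrum (𝓞 L₀))) : ssAbove L M (ssAbove L₀ L S₀) = ssAbove L₀ M S₀ := by
  ext w
  simp only [mem_ssAbove]
  rw [show (w.under (𝓞 L)).under (𝓞 L₀) = w.under (𝓞 L₀) from
    HeightOneSpectrum.ext (Ideal.under_under (A := 𝓞 L₀) (B := 𝓞 L) w.asIdeal)]

/-- **[J-IV] Theorem 4.6.1 (2), engine form — PROVED**: for every extension of number fields `M/L`, every finite set `S` of
primes of `L` and every finite set `T` of primes of `M` containing all primes above `S`:
`log d_L + log f_L(S) ≤ log d_M + log f_M(T)`. From the tree's kernel proof of the number-field content of [GenEll] Prop. 1.7 (i)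
(`GenEll.cond_sub_cond_le_logdisc_sub_logdisc`: `cond_L(S) − cond_M(T) ≤ logdisc M − logdisc L`) and `logDiff_eq_log_discr`.
Joshi's hypotheses (Initial Theta Data on `C`, `L`) are not needed for this item. [cite: MochizukiGenEll2010, Prop 1.7 (i) p.9] -/
theorem logDiffCond_le (S : Finset (HeightOneSpectrum (𝓞 L))) (T : Finset (HeightOneSpectrum (𝓞 M)))
    (hT : ∀ w : HeightOneSpectrum (𝓞 M), w.under (𝓞 L) ∈ S → w ∈ T) :
    logDiffCond L S ≤ logDiffCond M T := by
  have h := Literature.NumberTheory.DiophantineGeometry.GenEll.cond_sub_cond_le_logdisc_sub_logdisc L M S T hT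
  simp only [logDiffCond, logRedTate, logDiff_eq_log_discr]
  linarith

/-- **[J-IV] Theorem 4.6.1 (2)** (p.46 l.36–37) as printed, with `f_M` supported on `V^{odd,ss}_M = ssAbove L M S` — PROVED:
`0 ≤ (log d_M + log f_M) − (log d_L + log f_L)`. [cite: MochizukiGenEll2010, Prop 1.7 (i) p.9] -/
theorem thm461_2 (S : Finset (HeightOneSpectrum (𝓞 L))) :
    0 ≤ logDiffCond M (ssAbove L M S) - logDiffCond L S :=
  sub_nonneg.mpr (logDiffCond_le L M S _ fun _ hw => mem_ssAbove.mpr hw)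

/-! ### The quantities of Thm. 4.6.1 (1) and the remaining items, typed as claims -/

open scoped Classical in
/-- `ord_v(I)`: the multiplicity of the prime `v` in a nonzero ideal `I` of a Dedekind domain (the exponent in Mathlib's
`HeightOneSpectrum.maxPowDividing`); used for `d_{w|v} = ord_w(𝔡_{M/L})` ((4.6.4)) and `ord_v(e_{w|v})` ((4.6.11)). [folklore] -/
def ordIdeal {R : Type*} [CommRing R] [IsDedekindDomain R] (v : HeightOneSpectrum R) (I : Ideal R) : ℕ :=
  (Associates.mk v.asIdeal).count (Associates.mk I).factors

/-- **`d_{w|v}`** = `ord_w` of the relative different `𝔡_{𝓞_M/𝓞_L}` ([J-IV] (4.6.3)–(4.6.4) p.47 l.7–19, «d_{M_w/L_v}»; Mathlib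
`differentIdeal (𝓞 L) (𝓞 M)`). [claim: Joshi2024ATS4, status: disputed] -/
def relDiffExp (w : HeightOneSpectrum (𝓞 M)) : ℕ := ordIdeal w (differentIdeal (𝓞 L) (𝓞 M))

/-- **`e_{w|v}`**, the relative ramification index of `M_w/L_v` (§4.2 p.39 l.11; Mathlib `Ideal.ramificationIdx'`).
[claim: Joshi2024ATS4, status: disputed] -/
def relRamIdx (w : HeightOneSpectrum (𝓞 M)) : ℕ := ramificationIdx' (w.asIdeal.under (𝓞 L)) w.asIdeal

/-- **`f_{w|v}`**, the relative residue degree of `M_w/L_v` (§4.2 p.39 l.5–6; Mathlib `Ideal.inertiaDeg'`).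
[claim: Joshi2024ATS4, status: disputed] -/
def relInertiaDeg (w : HeightOneSpectrum (𝓞 M)) : ℕ := inertiaDeg' (w.asIdeal.under (𝓞 L)) w.asIdeal

/-- **`τ_{w|v} := d_{w|v} − (e_{w|v} − 1)`** ([J-IV] (4.6.4) p.47 l.16–24, [Bombieri–Gubler 2006, B.2.12] «Dedekind's Discriminant
Theorem»: `d = e − 1 + τ`, `τ = 0` if `w|v` is tamely ramified, `τ ∈ [1, e·ord_v(e)]` if wildly ramified; `e − 1 ≤ d` is Mathlib's
`pow_sub_one_dvd_differentIdeal`). [claim: Joshi2024ATS4, status: disputed] -/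
def tau (w : HeightOneSpectrum (𝓞 M)) : ℕ := relDiffExp L M w - (relRamIdx L M w - 1)

/-- The residue characteristic `p_w` of the prime `w` of `M` (§4.2 p.39 l.6; §4.5 (4.5.7) «p_v is the residue characteristic of v»).
[folklore] -/
def residueChar (w : HeightOneSpectrum (𝓞 M)) : ℕ := ringChar (𝓞 M ⧸ w.asIdeal)

/-- **`w|v` is (at worst) tamely ramified**: `p_w ∤ e_{w|v}` (Thm. 4.6.1 (1) p.46 l.34 «τ_{w|v} = 0 if and only if w|v is at worst
tamely ramified»; the residue fields are finite, so this is the standard notion). [claim: Joshi2024ATS4, status: disputed] -/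
def IsTameAt (w : HeightOneSpectrum (𝓞 M)) : Prop := ¬ residueChar M w ∣ relRamIdx L M w

/-- **`M/L` is tamely ramified** (at every prime; Thm. 4.6.1 (4) p.46 l.41). [claim: Joshi2024ATS4, status: disputed] -/
def IsTame : Prop := ∀ w : HeightOneSpectrum (𝓞 M), IsTameAt L M w

/-- At a prime `w` of `M` UNRAMIFIED over `L` one has `d_{w|v} = 0` (Mathlib: `¬ w ∣ 𝔡_{M/L} ↔` unramified,
`not_dvd_differentIdeal_iff`), hence `τ_{w|v} = 0` — the unramified case of (4.6.4). PROVED.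
[cite: BombieriGubler2006, Thm B.2.12] -/
theorem tau_eq_zero_of_isUnramifiedAt (w : HeightOneSpectrum (𝓞 M)) (hw : Algebra.IsUnramifiedAt (𝓞 L) w.asIdeal) :
    relDiffExp L M w = 0 ∧ tau L M w = 0 := by
  classical
  haveI := w.isPrime
  have hnd : ¬ w.asIdeal ∣ differentIdeal (𝓞 L) (𝓞 M) := not_dvd_differentIdeal_iff.mpr hw
  have hd : relDiffExp L M w = 0 := by
    by_contra hne
    apply hnd
    have hle := Associates.le_of_count_ne_zero (Associates.mk_ne_zero.mpr (differentIdeal_ne_bot (A := 𝓞 L) (B := 𝓞 M)))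
      ((Associates.irreducible_mk).mpr w.irreducible) hne
    exact Associates.mk_le_mk_iff_dvd.mp hle
  exact ⟨hd, by simp [tau, hd]⟩

/-- **[J-IV] Theorem 4.6.1 (1)** in the PROOF's form (4.6.8) (p.48 l.14–24; statement p.46 l.25–35, see flag F-a):
`(log d_M + log f_M) − (log d_L + log f_L) = (1/[M:ℚ])·Σ_{v ∈ V^non_L} Σ_{w|v} τ_{w|v}·f_{w|v}·log v` — here `f_{w|v}·log v = log N(w)`
and the double sum (finitely many nonzero terms) is Mathlib's `finsum`. HYPOTHESIS as printed: by flag F-b the printed derivation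
presupposes `M/L` unramified outside `V^{odd,ss}_L`; the identity that (4.6.3)–(4.6.5) actually give with `f` supported on
`V^{odd,ss}` carries the extra term `(1/[M:ℚ])·Σ_{w ∉ V^{odd,ss}_M} (e_{w|v} − 1)·log N(w) ≥ 0` on the right. Never asserted here.
[claim: Joshi2024ATS4, status: disputed] -/
@[claim "Joshi2024ATS4" "disputed"]
def Formula461 (S : Finset (HeightOneSpectrum (𝓞 L))) : Prop :=
  logDiffCond M (ssAbove L M S) - logDiffCond L S =
    (finrank ℚ M : ℝ)⁻¹ * ∑ᶠ w : HeightOneSpectrum (𝓞 M), (tau L M w : ℝ) * Real.log (absNorm w.asIdeal : ℝ)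

/-- **The bounds on `τ_{w|v}`** of (4.6.4) (p.47 l.20–24; statement (1) p.46 l.34–35, flag F-a): `τ_{w|v} = 0` iff `w|v` is tamely
ramified, and `1 ≤ τ_{w|v} ≤ e_{w|v}·ord_v(e_{w|v})` if wildly ramified ([Bombieri–Gubler 2006, B.2.12]; the local form for `p`-adic
fields is the tree's PROVED [IUTchIV] Prop. 1.3, `Literature.IUT.LogVolume.Prop13i/Prop13ii`, FACT-LIST F-2234/F-2235).
HYPOTHESIS here (the global tame/wild criterion `w^e ∣ 𝔡 ↔ p_w ∣ e` is not in Mathlib at this snapshot).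
[claim: Joshi2024ATS4, status: disputed] -/
@[claim "Joshi2024ATS4" "disputed"]
def TauBounds : Prop :=
  ∀ w : HeightOneSpectrum (𝓞 M),
    (tau L M w = 0 ↔ IsTameAt L M w) ∧
      (¬ IsTameAt L M w → 1 ≤ tau L M w ∧
        tau L M w ≤ relRamIdx L M w * ordIdeal (w.under (𝓞 L)) (Ideal.span {(relRamIdx L M w : 𝓞 L)}))

open scoped Classical in
/-- **[J-IV] Theorem 4.6.1 (3)** (p.46 l.38–40): the difference «depends only on primes v ∈ V_L which are wildly ramified in M/L»,
typed as the wild-support form of (4.6.8): the sum may be restricted to the wildly ramified `w`. HYPOTHESIS (flag F-b: fails as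
printed when `M/L` is tamely ramified at some prime outside `V^{odd,ss}_L`; located, not adjudicated).
[claim: Joshi2024ATS4, status: disputed] -/
@[claim "Joshi2024ATS4" "disputed"]
def DependsOnlyOnWild (S : Finset (HeightOneSpectrum (𝓞 L))) : Prop :=
  logDiffCond M (ssAbove L M S) - logDiffCond L S =
    (finrank ℚ M : ℝ)⁻¹ * ∑ᶠ w : HeightOneSpectrum (𝓞 M),
      if IsTameAt L M w then 0 else (tau L M w : ℝ) * Real.log (absNorm w.asIdeal : ℝ)

/-- **[J-IV] Theorem 4.6.1 (4)** (p.46 l.41): «(log d_M + log f_M) = (log d_L + log f_L) if and only if M/L is tamely ramified».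
HYPOTHESIS (flag F-b: with `f` supported on `V^{odd,ss}`, «tamely ramified» must be read «tame at V^{odd,ss} and unramified
elsewhere»). [claim: Joshi2024ATS4, status: disputed] -/
@[claim "Joshi2024ATS4" "disputed"]
def EqIffTame (S : Finset (HeightOneSpectrum (𝓞 L))) : Prop :=
  logDiffCond M (ssAbove L M S) = logDiffCond L S ↔ IsTame L M

/-- `S^ℚ_wild`, «the set of all rational primes which lie below primes in S_wild» (Thm. 4.6.1 (5) p.46 l.42–43): its cardinality.
[claim: Joshi2024ATS4, status: disputed] -/
def wildRationalCount (Swild : Finset (HeightOneSpectrum (𝓞 L))) : ℕ :=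
  (Swild.image fun v => ringChar (𝓞 L ⧸ v.asIdeal)).card

/-- **[J-IV] Theorem 4.6.1 (5)** (p.46 l.42–46; proof (4.6.9)–(4.6.14) p.48 l.30 – p.49 l.1): «(log d_M + log f_M) − (log d_L +
log f_L) ≤ #S^ℚ_wild · log[M : L]», for `M/L` wildly ramified only above `S_wild` (flag F-c: `S_wild` enters the theorem only
through Cor. 4.6.15; the proof p.48 l.55 uses «the sum is over all v ∈ S_wild»). HYPOTHESIS. [claim: Joshi2024ATS4, status: disputed] -/
@[claim "Joshi2024ATS4" "disputed"]
def WildBound (S Swild : Finset (HeightOneSpectrum (𝓞 L))) : Prop :=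
  (∀ w : HeightOneSpectrum (𝓞 M), ¬ IsTameAt L M w → w.under (𝓞 L) ∈ Swild) →
    logDiffCond M (ssAbove L M S) - logDiffCond L S ≤ wildRationalCount L Swild * Real.log (finrank L M)

/-- **[J-IV] Corollary 4.6.15** (p.49 l.4–18): given `0 < d`, `S ⊂ V^non_L`, `S_wild ⊂ S`, for the family of finite extensions `M/L`
with (1) `[M:L] ≤ d`, (2) `M` unramified outside `S`, (3) `M` tamely ramified outside `S_wild`: «there exists a constant 0 < c …
such that 0 ≤ (log d_M + log f_M) − (log d_L + log f_L) ≤ c», `c` depending on `(L, V^{odd,ss}_L, d, S, S_wild)` only (flag F-d).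
The lower bound is `cor4615_lower` (proved); the upper bound is the HYPOTHESIS (proof p.49 l.23–30: finitely many local extensions
of bounded degree). [claim: Joshi2024ATS4, status: disputed] -/
@[claim "Joshi2024ATS4" "disputed"]
def Cor4615 (V0 : Finset (HeightOneSpectrum (𝓞 L))) (d : ℕ) (S Swild : Finset (HeightOneSpectrum (𝓞 L))) : Prop :=
  ∃ c : ℝ, 0 < c ∧ ∀ (M : Type) [Field M] [NumberField M] [Algebra L M],
    finrank L M ≤ d →
    (∀ w : HeightOneSpectrum (𝓞 M), w.under (𝓞 L) ∉ S → Algebra.IsUnramifiedAt (𝓞 L) w.asIdeal) →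
    (∀ w : HeightOneSpectrum (𝓞 M), ¬ IsTameAt L M w → w.under (𝓞 L) ∈ Swild) →
      0 ≤ logDiffCond M (ssAbove L M V0) - logDiffCond L V0 ∧ logDiffCond M (ssAbove L M V0) - logDiffCond L V0 ≤ c

/-- **Cor. 4.6.15, lower bound — PROVED** for every member of every such family (indeed for every finite `M/L`): it is Thm. 4.6.1
(2). [cite: MochizukiGenEll2010, Prop 1.7 (i) p.9] -/
theorem cor4615_lower (V0 : Finset (HeightOneSpectrum (𝓞 L))) :
    0 ≤ logDiffCond M (ssAbove L M V0) - logDiffCond L V0 :=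
  thm461_2 L M V0

/-- If the family bound of Cor. 4.6.15 holds with constant `c`, then `c` bounds the difference for every member — the form in which
[J-IV] Thm. 6.1.1 / Thm. 7.1.1 consume it (slots T-30/T-33). Unfolding only. [claim: Joshi2024ATS4, status: disputed] -/
theorem cor4615_apply {V0 : Finset (HeightOneSpectrum (𝓞 L))} {d : ℕ} {S Swild : Finset (HeightOneSpectrum (𝓞 L))}
    (h : Cor4615 L V0 d S Swild) :
    ∃ c : ℝ, 0 < c ∧ ∀ (M : Type) [Field M] [NumberField M] [Algebra L M], finrank L M ≤ d →
      (∀ w : HeightOneSpectrum (𝓞 M), w.under (𝓞 L) ∉ S → Algebra.IsUnramifiedAt (𝓞 L) w.asIdeal) →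
      (∀ w : HeightOneSpectrum (𝓞 M), ¬ IsTameAt L M w → w.under (𝓞 L) ∈ Swild) →
        logDiffCond M (ssAbove L M V0) - logDiffCond L V0 ≤ c := by
  obtain ⟨c, hc, hfam⟩ := h
  exact ⟨c, hc, fun M _ _ _ hd hS hW => (hfam M hd hS hW).2⟩

end LogDiffCond

end Summit.ABC.IUTFork.Joshi.ATS4

end
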